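import Literature.NumberTheory.EllipticCurves.LocalRestrictionDegree
import Literature.NumberTheory.EllipticCurves.PeriodIndexSupportProofs
import Literature.NumberTheory.EllipticCurves.NeronOggShafarevichLocal
import Literature.NumberTheory.EllipticCurves.LocalFrobeniusGenerationProofs
import Literature.NumberTheory.EllipticCurves.HeegnerPointsKolyvaginCebotarevProofs
import HarnessLib

/-!
# Exact local descent of `H¹(K, E)` along the completions `K_v → L_w` of a quadratic extension:
# split places, and unramified places of good reduction (Milne, *ADT* I Prop. 3.8)

`Proofs` file (theorems only: no definition, no named fact, no instance) in topic
`NumberTheory/EllipticCurves`. The tree's `localRestrictionKer_le_of_tower` (`ShaRestriction`) says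
that along a tower of `K`-fields `K → K_v → L_w` a class of `H¹(K, E)` dying in `H¹(K_v, E)` dies
in `H¹(L_w, E)`; `LocalRestrictionDegree` gives the converse up to the local degree (`2 c` dies over
`K_v` when `c` dies over `L_w`, `[L_w : K_v] ≤ 2`). This file proves the EXACT converse — `c` dies
over `K_v` as soon as it dies over `L_w` — in the two situations where the local term
`H¹(Gal(L_w/K_v), E(L_w))` vanishes:

* `mem_localRestrictionKer_of_tower_of_finGalSubgroup_eq_top` — when `Γ_{K_v}` fixes (every copy
  of) `L_w`, i.e. `L_w = K_v` (**split places**); the factor of `LocalRestrictionDegree` is `1`;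
* `mem_localRestrictionKer_of_tower_of_inertia_le` — when `E` has **good reduction at `v`** and the
  local inertia group `I_𝔐 ≤ Γ_{K_v}` fixes every copy of `L_w` (`L_w/K_v` **unramified**): the
  kernel of `H¹(K_v, E) → H¹(L_w, E)` is inflated from cocycles vanishing on `Γ_{L̃_w} ⊇ I_𝔐`
  (`resKer_le_range_inflClass`), and a cocycle of `H¹(K_v, E)` vanishing on inertia has trivial
  class — Milne, *ADT* I Prop. 3.8, `H¹(K_v^nr/K_v, E(K_v^nr)) = 0` at good reduction, the tree's
  discharged `Milne2006_unramifiedClass_eq_zero_holds` (Lang's theorem + successive approximation).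

The two hypotheses are then DISCHARGED for a quadratic(-type) extension of number fields
`L = K + K θ`, `θ² = c ∈ K`, normal over `K`, at a finite place `w ∣ v` (the completion tower
`K_v → L_w` being `adicCompletionMap`): every `σ ∈ Γ_{K_v}` fixing the square root
`ι(emb θ) ∈ K̄_v` of `c` fixes every `K_v`-conjugate copy of `L_w = K_v + K_v θ` inside `K̄_v`
(private `mem_finGalSubgroup_adicCompletion_of_smul_eq`; `L_w = K_v + K_v θ` because the right side
is a closed `K_v`-subspace containing the dense image of `L`, private
`exists_eq_add_mul_adicCompletion`); and
`σ` (resp. `σ ∈ I_𝔐`) restricts into the decomposition (resp. inertia) group of the global prime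
`𝔓 = ι⁻¹(𝔐)` of `\bar ℤ_K` (`resGalOfEmb_mem_decompositionSubgroup_primeBelow`,
`resGalOfEmb_mem_inertia_primeBelow`), which fixes `emb(L)` when `v` SPLITS COMPLETELY in `L`
(`smul_eq_of_mem_stabilizer_of_ncard_primesOver_eq`: the decomposition group of `𝔓 ∩ 𝓞 L` in
`Gal(L/K)` has order `e f = 1`, Mathlib `Ideal.ncard_primesOver_mul_card_inertia_mul_finrank`), resp.
when `v` is UNRAMIFIED in `L` (the tree's `smul_eq_of_mem_inertia_of_isUnramifiedIn`). Whence

* `mem_localRestrictionKer_adicCompletion_of_ncard_primesOver_eq` — **split `v`**: for every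
  `W/K` (any reduction at `v`), `W.localRestrictionKer L_w ≤ W.localRestrictionKer K_v`;
* `mem_localRestrictionKer_adicCompletion_of_isUnramifiedIn` — **`v` unramified in `L` and `W`
  good at `v`**: `W.localRestrictionKer L_w ≤ W.localRestrictionKer K_v`.

These are the local terms of Dokchitser–Dokchitser's "kernel and cokernel of
`Sel(E/K) → Sel(E/F)^G` killed by `|G|²`" (Ann. of Math. 172 (2010), proof of Lemma 4.14) at the
places where they VANISH, and the plumbing binder (desc-fin) of the over-`ℚ` `2`-descent of
Kolyvagin's method at `p = 2` (`Summits/…/Theorems/CMKolyvaginAtInertTwoRationalDescentAtTwoDual.lean`).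
Everything here is proved.

## References

* J. S. Milne, *Arithmetic Duality Theorems*, 2nd ed. (2006), Ch. I Prop. 3.8 and §6.
  [MilneADT2006]
* T. Dokchitser, V. Dokchitser, *On the Birch–Swinnerton-Dyer quotients modulo squares*, Ann. of
  Math. 172 (2010), Lemma 4.14 (proof). [DokchitserDokchitserAnnals2010]
* J.-P. Serre, *Galois Cohomology* (1997), I.§2.4, I.§5.8 (inflation–restriction), II.§1.1.
  [SerreGaloisCohomology1997]
* J. Neukirch, *Algebraic Number Theory* (1999), Ch. I §9 (decomposition and inertia groups,
  (9.2)–(9.6)), Ch. II §8–§9. [NeukirchANT1999]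
* D. A. Marcus, *Number Fields* (2nd ed. 2018), Ch. 4, Thm. 28–29 and Corollary (a prime splits
  completely iff its decomposition group is trivial). [Marcus2018]
-/

noncomputable section

open scoped Classical Pointwise

universe u v

namespace Literature.NumberTheory.EllipticCurves

open GaloisRepresentations WeierstrassCurve IntermediateField Field NumberField IsDedekindDomain

/-! ## §1 Exact descent along a tower `K → E → E'` when the local term vanishes -/

section Abstract

variable {K : Type u} [Field K] (W : WeierstrassCurve K)
variable {E : Type u} [Field E] [Algebra K E]
variable {E' : Type u} [Field E'] [Algebra K E'] [Algebra E E'] [IsScalarTower K E E']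
variable [FiniteDimensional E E'] [CharZero E]

/-- **Exact descent when `Γ_E` fixes every copy of `E'`** (`[L̃' : E] = 1`, e.g. `E' = E`: split
places): a class of `H¹(K, E)` dying in `H¹(E', E)` dies in `H¹(E, E)` — the tree's
`index_nsmul_mem_localRestrictionKer_of_tower` with index `[Γ_E : Γ_{Ẽ'}] = 1`.
[cite: SerreGaloisCohomology1997, I.§2.4 Cor. to Prop. 9] -/
theorem mem_localRestrictionKer_of_tower_of_finGalSubgroup_eq_top
    (htop : finGalSubgroup (E := E) E' = ⊤) {c : W.galH1} (hc : c ∈ W.localRestrictionKer E') :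
    c ∈ W.localRestrictionKer E := by
  have h := index_nsmul_mem_localRestrictionKer_of_tower (E := E) W hc
  rwa [htop, Subgroup.index_top, one_nsmul] at h

omit [FiniteDimensional E E'] [CharZero E] in
/-- **An element of `Γ_E` fixing every `E`-conjugate copy of `E'` in `Ē` lies in `Γ_{Ẽ'}`**
(`finGalSubgroup E'`, the fixing subgroup of the normal closure `Ẽ' = ⨆ⱼ j(E')`,
Mathlib `normalClosure_le_iff`). [folklore] -/
private theorem mem_finGalSubgroup_of_forall_apply_eq (σ : Field.absoluteGaloisGroup E)
    (h : ∀ (j : E' →ₐ[E] AlgebraicClosure E) (x : E'),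
      absoluteGaloisGroup.toAlgEquiv E σ (j x) = j x) :
    σ ∈ finGalSubgroup (E := E) E' := by
  have hle : finGaloisClosure (E := E) E' ≤
      IntermediateField.fixedField (Subgroup.zpowers (absoluteGaloisGroup.toAlgEquiv E σ)) := by
    unfold finGaloisClosure
    rw [normalClosure_le_iff]
    intro j y hy
    obtain ⟨x, rfl⟩ := (AlgHom.mem_fieldRange (f := j)).mp hy
    rw [IntermediateField.mem_fixedField_iff]
    intro φ hφ
    have hst : φ ∈ MulAction.stabilizer (AlgebraicClosure E ≃ₐ[E] AlgebraicClosure E) (j x) :=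
      (Subgroup.zpowers_le.mpr (MulAction.mem_stabilizer_iff.mpr (h j x))) hφ
    exact MulAction.mem_stabilizer_iff.mp hst
  exact (IntermediateField.le_iff_le _ _).mp hle (Subgroup.mem_zpowers _)

variable {W} in
/-- **Exact descent at a place of good reduction along an unramified tower** (Milne, *ADT* I
Prop. 3.8). Let `W/K` be an elliptic curve over a number field with good reduction at the finite
place `v`, `E' ⊇ K_v` a finite extension of the completion (a `K`-field compatibly), and suppose the
local inertia group `I_𝔐 ≤ Γ_{K_v}` (of a prime `𝔐` of `\bar 𝓞_v` above `𝓂_v`) fixes every copy of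
`E'` in `K̄_v` (`I_𝔐 ≤ Γ_{Ẽ'}`: `E'/K_v` unramified). Then a class `c ∈ H¹(K, E)` dying in
`H¹(E', E)` dies in `H¹(K_v, E)`: as in `index_nsmul_mem_localRestrictionKer_of_tower` its image in
`H¹(K_v, E)` is the class of a cocycle vanishing on `Γ_{Ẽ'}` (`resKer_le_range_inflClass`), hence
on `I_𝔐`, and such a class is `0` because `H¹(K_v^nr/K_v, E(K_v^nr)) = 0` at good reduction
(`Milne2006_unramifiedClass_eq_zero_holds`). [cite: MilneADT2006, Ch. I Prop. 3.8]
[cite: SerreGaloisCohomology1997, I.§5.8] -/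
theorem mem_localRestrictionKer_of_tower_of_inertia_le {K : Type u} [Field K] [NumberField K]
    {W : WeierstrassCurve K} [W.IsElliptic] {v : HeightOneSpectrum (𝓞 K)}
    (hgood : W.HasGoodReductionAt v) {E' : Type u} [Field E'] [Algebra K E']
    [Algebra (v.adicCompletion K) E'] [IsScalarTower K (v.adicCompletion K) E']
    [FiniteDimensional (v.adicCompletion K) E'] {𝔐 : Ideal v.localAbsIntegers}
    (h𝔐 : 𝔐 ∈ v.localPrimesAbove)
    (hI : 𝔐.inertia (absoluteGaloisGroup (v.adicCompletion K)) ≤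
      finGalSubgroup (E := v.adicCompletion K) E')
    {c : W.galH1} (hc : c ∈ W.localRestrictionKer E') :
    c ∈ W.localRestrictionKer (v.adicCompletion K) := by
  let ι₁ : AlgebraicClosure K →ₐ[K] AlgebraicClosure (v.adicCompletion K) :=
    closureEmb (K := K) (v.adicCompletion K)
  let ι₂ : AlgebraicClosure (v.adicCompletion K) →ₐ[v.adicCompletion K] AlgebraicClosure E' :=
    closureEmb (K := v.adicCompletion K) E'
  rw [← WeierstrassCurve.localRestrictionKerOfEmb_eq_holds W E' ((ι₂.restrictScalars K).comp ι₁)]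
    at hc
  change c ∈ resKer (resGalOfEmb ((ι₂.restrictScalars K).comp ι₁))
    (pointsMapOfEmb W ((ι₂.restrictScalars K).comp ι₁)) (pointsMapOfEmb_smul W _) at hc
  rw [resKer_eq_ker, AddMonoidHom.mem_ker,
    resH1Hom_congr (resGalOfEmb_comp_tower ι₁ ι₂) (pointsMapOfEmb_comp_tower W ι₁ ι₂) _
      (fun x m ↦ by
        simp only [ContinuousMonoidHom.comp_toFun, AddMonoidHom.coe_comp, Function.comp_apply,
          pointsMapOfEmb_smul, pointsMapTower_smul]),
    ← resH1Hom_comp (resGalOfEmb ι₁) (pointsMapOfEmb W ι₁) (pointsMapOfEmb_smul W ι₁)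
      (resGalOfEmb (K := v.adicCompletion K) ι₂) _ (pointsMapTower_smul W ι₂), AddMonoidHom.comp_apply,
    ← AddMonoidHom.mem_ker, ← resKer_eq_ker] at hc
  -- the image of `c` in `H¹(K_v, E)` is inflated from a cocycle vanishing on `Γ_{Ẽ'} ⊇ I_𝔐`
  obtain ⟨f, hf⟩ := resKer_le_range_inflClass (resGalOfEmb (K := v.adicCompletion K) ι₂)
    (pointsMapTower W ι₂) (pointsMapTower_smul W ι₂) (pointsMapTower_bijective W ι₂)
    (finGalSubgroup (E := v.adicCompletion K) E') (isOpen_finGalSubgroup E')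
    (finGalSubgroup_le_range_resGal E') hc
  -- Milne, ADT I.3.8: a class of `H¹(K_v, E)` with a cocycle vanishing on inertia is trivial
  have h0 : inflClass (localPoints W (v.adicCompletion K)) (finGalSubgroup (E := v.adicCompletion K) E')
      (isOpen_finGalSubgroup E') f = 0 := by
    rw [inflClass_apply]
    exact Milne2006_unramifiedClass_eq_zero_holds W v hgood h𝔐 _ fun σ hσ ↦ by
      rw [toContOneCocycle_apply]
      exact cocyclesVanishingOn.apply_of_mem f (hI hσ)
  change resH1Hom (resGalOfEmb ι₁) (pointsMapOfEmb W ι₁) (pointsMapOfEmb_smul W ι₁) c = 0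
  rw [← hf, h0]

end Abstract

/-! ## §2 Global inputs: decomposition groups at a completely split place fix the field -/

section Global

variable {k : Type u} [Field k] [NumberField k]
variable (M : Type v) [Field M] [Algebra k M] [FiniteDimensional k M] [Normal k M]
  (emb : M →ₐ[k] AlgebraicClosure k)

/-- **The decomposition group at a completely split place of a finite normal `M/k` acts trivially
on `M`.** For an embedding `emb : M → k̄`, a finite place `w` of `k` with `[M : k]` primes of `𝓞 M`
above it (`w` splits completely) and a prime `𝔓 ∣ w` of `\bar ℤ_k`, every `g ∈ Γ_k` with
`g 𝔓 = 𝔓` fixes `emb(M)` pointwise: the image of `g` in `Gal(M/k)` stabilises `P = 𝔓 ∩ 𝓞 M`, and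
the decomposition group of `P` has `e(P|w) f(P|w) = [M : k] / #{P' ∣ w} = 1` element (Mathlib
`Ideal.ncard_primesOver_mul_card_inertia_mul_finrank`, `Ideal.card_stabilizer_eq_card_inertia_mul_finrank`).
The decomposition twin of the tree's `smul_eq_of_mem_inertia_of_isUnramifiedIn`.
[cite: NeukirchANT1999, Ch. I §9 Prop. (9.2)–(9.3)] [cite: Marcus2018, Ch. 4 Thm. 28 and Cor. to Thm. 29] -/
theorem smul_eq_of_mem_stabilizer_of_ncard_primesOver_eq {w : HeightOneSpectrum (𝓞 k)}
    (hsplit : (w.asIdeal.primesOver (𝓞 M)).ncard = Module.finrank k M)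
    {𝔓 : Ideal (absIntegers (𝓞 k) k)} (h𝔓 : 𝔓 ∈ w.primesAbove)
    {g : absoluteGaloisGroup k} (hg : g ∈ 𝔓.decompositionSubgroup (absoluteGaloisGroup k)) (y : M) :
    g • emb y = emb y := by
  classical
  haveI := h𝔓.1
  haveI : IsGalois k M := ⟨⟩
  haveI : NumberField M := NumberField.of_module_finite k M
  haveI : Module.Finite (𝓞 k) (𝓞 M) := IsIntegralClosure.finite (𝓞 k) k M (𝓞 M)
  haveI : IsGaloisGroup (M ≃ₐ[k] M) (𝓞 k) (𝓞 M) :=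
    IsGaloisGroup.of_isFractionRing (M ≃ₐ[k] M) (𝓞 k) (𝓞 M) k M
  set G := M ≃ₐ[k] M
  -- `𝓞 M → \bar ℤ_k` along `emb`
  let ι : 𝓞 M →+* absIntegers (𝓞 k) k :=
    (emb.toRingHom.comp (algebraMap (𝓞 M) M)).codRestrict (absIntegers (𝓞 k) k) fun x ↦ by
      change emb (algebraMap (𝓞 M) M x) ∈ integralClosure (𝓞 k) (AlgebraicClosure k)
      rw [mem_integralClosure_iff]
      have hx : IsIntegral ℤ (emb (algebraMap (𝓞 M) M x)) :=
        (RingOfIntegers.isIntegral_coe x).map (emb.restrictScalars ℤ)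
      exact hx.tower_top
  have hιcoe : ∀ x : 𝓞 M, (ι x : AlgebraicClosure k) = emb (x : M) := fun _ ↦ rfl
  have hιcomp : ι.comp (algebraMap (𝓞 k) (𝓞 M)) = algebraMap (𝓞 k) (absIntegers (𝓞 k) k) := by
    ext r
    change emb ((algebraMap (𝓞 k) (𝓞 M) r : M)) = algebraMap (𝓞 k) (AlgebraicClosure k) r
    rw [show ((algebraMap (𝓞 k) (𝓞 M) r : M)) = algebraMap k M (r : k) from rfl, emb.commutes,
      IsScalarTower.algebraMap_apply (𝓞 k) k (AlgebraicClosure k)]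
  -- the prime `P = 𝔓 ∩ 𝓞 M` below `𝔓`
  set P : Ideal (𝓞 M) := 𝔓.comap ι with hPdef
  haveI hPprime : P.IsPrime := Ideal.comap_isPrime ι 𝔓
  haveI hPover : P.LiesOver w.asIdeal := by
    constructor
    change w.asIdeal = Ideal.comap (algebraMap (𝓞 k) (𝓞 M)) (Ideal.comap ι 𝔓)
    rw [Ideal.comap_comap, hιcomp]
    exact h𝔓.2.over
  haveI : w.asIdeal.IsMaximal := w.isMaximal
  -- the decomposition group of `P` in `G` is trivial (`w` splits completely)
  have hG : Nat.card G = Module.finrank k M := IsGalois.card_aut_eq_finrank k M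
  have hfund := Ideal.ncard_primesOver_mul_card_inertia_mul_finrank (G := G) w.asIdeal P
  rw [hsplit, hG, mul_assoc] at hfund
  have hpos : 0 < Module.finrank k M := Module.finrank_pos
  have hone : Nat.card (P.inertia G) * P.inertiaDeg (𝓞 k) = 1 := by
    have h := hfund
    conv_rhs at h => rw [← mul_one (Module.finrank k M)]
    exact Nat.eq_of_mul_eq_mul_left hpos h
  have hcard : Nat.card (MulAction.stabilizer G P) = 1 := by
    rw [Ideal.card_stabilizer_eq_card_inertia_mul_finrank (G := G) w.asIdeal P, hone]
  have hbot : MulAction.stabilizer G P = ⊥ := Subgroup.eq_bot_of_card_eq _ hcard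
  -- `M` as a subextension of `k̄` through `emb`, and the image of `Γ_k` in `G`
  letI : Algebra M (AlgebraicClosure k) := emb.toRingHom.toAlgebra
  haveI : IsScalarTower k M (AlgebraicClosure k) :=
    IsScalarTower.of_algebraMap_eq fun x ↦ (emb.commutes x).symm
  let r : absoluteGaloisGroup k →* G :=
    (AlgEquiv.restrictNormalHom M).comp (absoluteGaloisGroup.toAlgEquiv k).toMonoidHom
  have hrc : ∀ (σ : absoluteGaloisGroup k) (y : M), emb (r σ y) = σ • emb y := fun σ y ↦
    AlgEquiv.restrictNormal_commutes (absoluteGaloisGroup.toAlgEquiv k σ) M y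
  have hrι : ∀ (σ : absoluteGaloisGroup k) (b : 𝓞 M), ι (r σ • b) = σ • ι b := by
    intro σ b
    apply Subtype.ext
    rw [integralClosure.coe_smul, hιcoe, hιcoe]
    exact hrc σ b
  -- `r g` stabilises `P`
  have hgP : r g ∈ P.decompositionSubgroup G := by
    rw [Ideal.mem_decompositionSubgroup_iff]
    ext b
    rw [Ideal.mem_pointwise_smul_iff_inv_smul_mem, hPdef, Ideal.mem_comap, Ideal.mem_comap,
      ← map_inv, hrι, ← Ideal.mem_pointwise_smul_iff_inv_smul_mem,
      Ideal.mem_decompositionSubgroup_iff.mp hg]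
  change r g ∈ MulAction.stabilizer G P at hgP
  rw [hbot, Subgroup.mem_bot] at hgP
  have h := hrc g y
  rw [hgP, AlgEquiv.one_apply] at h
  exact h.symm

end Global

/-! ## §3 Local-to-global: `Γ_{K_v}` restricts into the decomposition group of `𝔓 = ι⁻¹(𝔐)` -/

section LocalToGlobal

variable {K : Type u} [Field K] [NumberField K] (v : HeightOneSpectrum (𝓞 K))
  (ι : AlgebraicClosure K →ₐ[K] AlgebraicClosure (v.adicCompletion K))

/-- **The local Galois group restricts into the global decomposition group.** For a `K`-embedding
`ι : K̄ → K̄_v` and a prime `𝔐` of `\bar 𝓞_v` above `𝓂_v`, every `σ ∈ Γ_{K_v}` fixes `𝔐`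
(`K_v` is henselian: `smul_eq_of_mem_localPrimesAbove`), so its restriction `res_ι σ ∈ Γ_K` fixes the
prime `𝔓_{ι,𝔐} = ι⁻¹(𝔐) ∩ \bar ℤ_K`: the image of `Γ_{K_v}` lies in the decomposition group
`D_{𝔓}`. Neukirch, *ANT*, II (9.6) (`G(L_w|K_v) ≅ G_w(L|K)`). [cite: NeukirchANT1999, Ch. II §9 Prop. (9.6)] -/
theorem resGalOfEmb_mem_decompositionSubgroup_primeBelow {𝔐 : Ideal v.localAbsIntegers}
    (h𝔐 : 𝔐 ∈ v.localPrimesAbove) (σ : absoluteGaloisGroup (v.adicCompletion K)) :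
    resGalOfEmb ι σ ∈ (v.primeBelow ι 𝔐).decompositionSubgroup (absoluteGaloisGroup K) := by
  have key : ∀ (τ : absoluteGaloisGroup (v.adicCompletion K)) (b : absIntegers (𝓞 K) K),
      v.absIntegersToLocal ι (resGalOfEmb ι τ • b) = τ • v.absIntegersToLocal ι b := by
    intro τ b
    apply Subtype.ext
    rw [HeightOneSpectrum.coe_absIntegersToLocal_apply, integralClosure.coe_smul,
      integralClosure.coe_smul, HeightOneSpectrum.coe_absIntegersToLocal_apply]
    exact apply_resGalAuxOfEmb_apply ι τ b
  rw [Ideal.mem_decompositionSubgroup_iff]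
  ext b
  rw [Ideal.mem_pointwise_smul_iff_inv_smul_mem, HeightOneSpectrum.mem_primeBelow_iff,
    HeightOneSpectrum.mem_primeBelow_iff, ← map_inv, key,
    ← Ideal.mem_pointwise_smul_iff_inv_smul_mem,
    HeightOneSpectrum.smul_eq_of_mem_localPrimesAbove v h𝔐 σ]

end LocalToGlobal

/-! ## §4 Completions of `L = K + K θ`: every `σ` fixing `√c` fixes every copy of `L_w` -/

section Completion

variable {K : Type u} [Field K] [NumberField K] (L : Type u) [Field L] [NumberField L] [Algebra K L]

/-- **`L_w = K_v + K_v θ` at a finite place `w ∣ v`** when `L = K + K θ`: the `K_v`-span of `1, θ`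
in `L_w` is finite-dimensional, hence closed (`Submodule.closed_of_finiteDimensional`), and contains
the dense image of `L` (`HeightOneSpectrum.denseRange_algebraMap`), so it is everything (the
argument of Mathlib's `Module.Finite K_v L_w`; verbatim the tree's private lemma of
`ShaRestrictionJZeroLocalDescent`). [folklore] -/
private theorem exists_eq_add_mul_adicCompletion {θ : L}
    (hL : ∀ x : L, ∃ a b : K, x = algebraMap K L a + algebraMap K L b * θ)
    (v : HeightOneSpectrum (𝓞 K)) (w : HeightOneSpectrum (𝓞 L)) [w.asIdeal.LiesOver v.asIdeal]
    (y : w.adicCompletion L) :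
    ∃ a b : v.adicCompletion K, y = adicCompletionMap (K := K) L v w a +
      adicCompletionMap (K := K) L v w b * algebraMap L (w.adicCompletion L) θ := by
  have hcont : Continuous (adicCompletionMap (K := K) L v w) := by
    unfold adicCompletionMap
    exact (HeightOneSpectrum.adicCompletion.continuous_ofCompletion L w).comp
      ((UniformSpace.Completion.continuous_map).comp
        (HeightOneSpectrum.adicCompletion.continuous_toCompletion K v))
  have hcoe : ∀ x : K, adicCompletionMap (K := K) L v w (algebraMap K (v.adicCompletion K) x) =
      algebraMap L (w.adicCompletion L) (algebraMap K L x) := fun x ↦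
    adicCompletionMap_coe (K := K) L v w x
  letI : Algebra (v.adicCompletion K) (w.adicCompletion L) :=
    (adicCompletionMap (K := K) L v w).toAlgebra
  haveI : ContinuousSMul (v.adicCompletion K) (w.adicCompletion L) :=
    ⟨(hcont.comp continuous_fst).mul continuous_snd⟩
  -- the closed subspace `S = K_v + K_v θ`
  let S : Submodule (v.adicCompletion K) (w.adicCompletion L) :=
    Submodule.span (v.adicCompletion K) {1, algebraMap L (w.adicCompletion L) θ}
  haveI : FiniteDimensional (v.adicCompletion K) S :=
    FiniteDimensional.span_of_finite _ ((Set.finite_singleton _).insert _)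
  have hSclosed : IsClosed (S : Set (w.adicCompletion L)) := by
    -- `K_v` as a nontrivially normed field (Mathlib's `Valued.toNontriviallyNormedField`, scoped)
    open scoped Valued in exact S.closed_of_finiteDimensional
  -- `S` contains the dense image of `L`
  have h1 : (1 : w.adicCompletion L) ∈ S := Submodule.subset_span (Set.mem_insert _ _)
  have hθS : algebraMap L (w.adicCompletion L) θ ∈ S :=
    Submodule.subset_span (Set.mem_insert_of_mem _ (Set.mem_singleton _))
  have hKS : ∀ a : K, algebraMap L (w.adicCompletion L) (algebraMap K L a) =
      algebraMap K (v.adicCompletion K) a • (1 : w.adicCompletion L) := fun a ↦ by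
    rw [Algebra.smul_def, mul_one, RingHom.algebraMap_toAlgebra, hcoe]
  have hLS : Set.range (algebraMap L (w.adicCompletion L)) ⊆ S := by
    rintro _ ⟨l, rfl⟩
    obtain ⟨a, b, rfl⟩ := hL l
    rw [map_add, map_mul, hKS a, hKS b, smul_mul_assoc, one_mul]
    exact S.add_mem (S.smul_mem _ h1) (S.smul_mem _ hθS)
  have hSuniv : (S : Set (w.adicCompletion L)) = Set.univ := by
    apply Set.eq_univ_of_univ_subset
    rw [← (HeightOneSpectrum.denseRange_algebraMap L w).closure_range]
    exact closure_minimal hLS hSclosed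
  have hy : y ∈ S := by
    rw [← SetLike.mem_coe, hSuniv]
    exact Set.mem_univ y
  obtain ⟨a, b, hab⟩ := Submodule.mem_span_pair.mp hy
  refine ⟨a, b, ?_⟩
  rw [← hab, Algebra.smul_def, Algebra.smul_def, mul_one, RingHom.algebraMap_toAlgebra]

/-- **Every `σ ∈ Γ_{K_v}` fixing a square root of `c` in `K̄_v` fixes every copy of `L_w`.** Let
`L = K + K θ` with `θ² = c ∈ K`, `w ∣ v` finite places, `L_w` a `K_v`-algebra through the map of
completions `K_v → L_w` (`halg`), `emb : L → K̄` a `K`-embedding and `ι : K̄ → K̄_v` a `K`-embedding.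
If `σ ∈ Γ_{K_v}` fixes `ι(emb θ)` then `σ ∈ Γ_{L̃_w}` (`finGalSubgroup L_w`): for every
`K_v`-embedding `j : L_w → K̄_v`, `j(L_w) = K_v + K_v j(θ)` (`exists_eq_add_mul_adicCompletion`) and
`j(θ) = ± ι(emb θ)` (both square to `c`), so `σ` fixes `j(L_w)` pointwise
(`mem_finGalSubgroup_of_forall_apply_eq`). [folklore] -/
private theorem mem_finGalSubgroup_adicCompletion_of_smul_eq {θ : L} {c : K}
    (hθ : θ ^ 2 = algebraMap K L c)
    (hL : ∀ x : L, ∃ a b : K, x = algebraMap K L a + algebraMap K L b * θ)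
    (v : HeightOneSpectrum (𝓞 K)) (w : HeightOneSpectrum (𝓞 L)) [w.asIdeal.LiesOver v.asIdeal]
    [Algebra (v.adicCompletion K) (w.adicCompletion L)]
    (halg : algebraMap (v.adicCompletion K) (w.adicCompletion L) = adicCompletionMap (K := K) L v w)
    (emb : L →ₐ[K] AlgebraicClosure K)
    (ι : AlgebraicClosure K →ₐ[K] AlgebraicClosure (v.adicCompletion K))
    {σ : absoluteGaloisGroup (v.adicCompletion K)} (hσ : σ • ι (emb θ) = ι (emb θ)) :
    σ ∈ finGalSubgroup (E := v.adicCompletion K) (w.adicCompletion L) := by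
  set Kv := v.adicCompletion K
  set Lw := w.adicCompletion L
  set γ : AlgebraicClosure Kv := ι (emb θ) with hγ
  have hγ2 : γ ^ 2 = algebraMap K (AlgebraicClosure Kv) c := by
    rw [hγ, ← map_pow, ← map_pow, hθ, emb.commutes, ι.commutes]
  have hσ' : absoluteGaloisGroup.toAlgEquiv Kv σ γ = γ := hσ
  refine mem_finGalSubgroup_of_forall_apply_eq (E := Kv) (E' := Lw) σ fun j x ↦ ?_
  obtain ⟨a, b, rfl⟩ := exists_eq_add_mul_adicCompletion L hL v w x
  rw [← halg]
  -- `j(θ)` is a square root of `c`, hence `± γ`, hence fixed by `σ`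
  have hjθ2 : (j (algebraMap L Lw θ)) ^ 2 = algebraMap K (AlgebraicClosure Kv) c := by
    rw [← map_pow, ← map_pow, hθ]
    have h1 : algebraMap L Lw (algebraMap K L c) = algebraMap Kv Lw (algebraMap K Kv c) := by
      rw [halg]
      exact (adicCompletionMap_coe (K := K) L v w c).symm
    rw [h1, j.commutes, ← IsScalarTower.algebraMap_apply]
  have hfix : absoluteGaloisGroup.toAlgEquiv Kv σ (j (algebraMap L Lw θ)) = j (algebraMap L Lw θ) := by
    rw [← hγ2] at hjθ2
    rcases sq_eq_sq_iff_eq_or_eq_neg.mp hjθ2 with h | h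
    · rw [h, hσ']
    · rw [h, map_neg, hσ']
  rw [map_add, map_mul, map_add, map_mul, j.commutes, j.commutes, AlgEquiv.commutes,
    AlgEquiv.commutes, hfix]

end Completion

/-! ## §5 Exact local descent at the completions of a quadratic-type extension -/

section NumberField

variable {K : Type u} [Field K] [NumberField K] (W : WeierstrassCurve K)
variable (L : Type u) [Field L] [NumberField L] [Algebra K L] [Normal K L]

/-- **Split places: `H¹(K, E) → H¹(K_v, E)` and `→ H¹(L_w, E)` have the same kernel.** Let
`L = K + K θ`, `θ² = c ∈ K`, be normal over `K`, `v` a finite place of `K` with `[L : K]` primes of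
`𝓞 L` above it (`v` splits completely in `L`) and `w ∣ v`. Then for every `W/K` a class of
`H¹(K, E)` dying in `H¹(L_w, E)` dies in `H¹(K_v, E)`: every `σ ∈ Γ_{K_v}` restricts into the
decomposition group of `𝔓 = ι⁻¹(𝔐)` (`resGalOfEmb_mem_decompositionSubgroup_primeBelow`), which fixes `emb(L)`
(`smul_eq_of_mem_stabilizer_of_ncard_primesOver_eq`), so `σ` fixes `ι(emb θ)` and hence every copy
of `L_w` (`mem_finGalSubgroup_adicCompletion_of_smul_eq`): `Γ_{L̃_w} = Γ_{K_v}` (`L_w = K_v`) and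
`mem_localRestrictionKer_of_tower_of_finGalSubgroup_eq_top` applies. (Dokchitser–Dokchitser, proof
of Lemma 4.14: at a split place the local term `H¹(Gal(L_w/K_v), E(L_w))` is `0`.)
[cite: DokchitserDokchitserAnnals2010, Lemma 4.14 (proof)] [cite: NeukirchANT1999, Ch. II §9 Prop. (9.6)] -/
theorem mem_localRestrictionKer_adicCompletion_of_ncard_primesOver_eq {θ : L} {c : K}
    (hθ : θ ^ 2 = algebraMap K L c)
    (hL : ∀ x : L, ∃ a b : K, x = algebraMap K L a + algebraMap K L b * θ)
    {v : HeightOneSpectrum (𝓞 K)} (hsplit : (v.asIdeal.primesOver (𝓞 L)).ncard = Module.finrank K L)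
    (w : HeightOneSpectrum (𝓞 L)) [w.asIdeal.LiesOver v.asIdeal]
    {x : W.galH1} (hx : x ∈ W.localRestrictionKer (w.adicCompletion L)) :
    x ∈ W.localRestrictionKer (v.adicCompletion K) := by
  letI : Algebra (v.adicCompletion K) (w.adicCompletion L) :=
    (adicCompletionMap (K := K) L v w).toAlgebra
  haveI : IsScalarTower K (v.adicCompletion K) (w.adicCompletion L) :=
    IsScalarTower.of_algebraMap_eq fun x ↦ (adicCompletionMap_coe (K := K) L v w x).symm
  haveI : FiniteDimensional (v.adicCompletion K) (w.adicCompletion L) :=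
    (finrank_adicCompletion_le_of_liesOver L v w).1
  haveI : CharZero (v.adicCompletion K) :=
    charZero_of_injective_algebraMap (algebraMap K (v.adicCompletion K)).injective
  haveI : FiniteDimensional K L := Module.Finite.of_restrictScalars_finite ℚ K L
  obtain ⟨𝔐, h𝔐⟩ := v.localPrimesAbove_nonempty
  let emb : L →ₐ[K] AlgebraicClosure K := IsAlgClosed.lift
  let ι : AlgebraicClosure K →ₐ[K] AlgebraicClosure (v.adicCompletion K) :=
    closureEmb (K := K) (v.adicCompletion K)
  have htop : finGalSubgroup (E := v.adicCompletion K) (w.adicCompletion L) = ⊤ := by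
    refine eq_top_iff.mpr fun σ _ ↦ ?_
    refine mem_finGalSubgroup_adicCompletion_of_smul_eq L hθ hL v w rfl emb ι ?_
    have hρ := resGalOfEmb_mem_decompositionSubgroup_primeBelow v ι h𝔐 σ
    have h := smul_eq_of_mem_stabilizer_of_ncard_primesOver_eq L emb hsplit
      (HeightOneSpectrum.primeBelow_mem_primesAbove h𝔐) hρ θ
    calc σ • ι (emb θ)
        = ι ((show AlgebraicClosure K ≃ₐ[K] AlgebraicClosure K from resGalAuxOfEmb ι σ) (emb θ)) :=
          (apply_resGalAuxOfEmb_apply ι σ (emb θ)).symm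
      _ = ι (emb θ) := congrArg ι h
  exact mem_localRestrictionKer_of_tower_of_finGalSubgroup_eq_top W htop hx

variable [W.IsElliptic]

/-- **Unramified places of good reduction: `H¹(K, E) → H¹(K_v, E)` and `→ H¹(L_w, E)` have the
same kernel** (Milne, *ADT* I Prop. 3.8). Let `L = K + K θ`, `θ² = c ∈ K`, be normal over `K`, `v`
a finite place of `K` unramified in `L` at which the elliptic curve `W/K` has good reduction, and
`w ∣ v`. Then a class of `H¹(K, E)` dying in `H¹(L_w, E)` dies in `H¹(K_v, E)`: the local inertia
group `I_𝔐 ≤ Γ_{K_v}` restricts into the global inertia group of `𝔓 = ι⁻¹(𝔐)`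
(`resGalOfEmb_mem_inertia_primeBelow`), which fixes `emb(L)` (`smul_eq_of_mem_inertia_of_isUnramifiedIn`),
so `I_𝔐` fixes every copy of `L_w` (`mem_finGalSubgroup_adicCompletion_of_smul_eq`) and
`mem_localRestrictionKer_of_tower_of_inertia_le` applies. (Dokchitser–Dokchitser, proof of
Lemma 4.14: at an unramified good place the local term `H¹(Gal(L_w/K_v), E(L_w))` is `0`.)
[cite: MilneADT2006, Ch. I Prop. 3.8] [cite: DokchitserDokchitserAnnals2010, Lemma 4.14 (proof)] -/
theorem mem_localRestrictionKer_adicCompletion_of_isUnramifiedIn {θ : L} {c : K}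
    (hθ : θ ^ 2 = algebraMap K L c)
    (hL : ∀ x : L, ∃ a b : K, x = algebraMap K L a + algebraMap K L b * θ)
    {v : HeightOneSpectrum (𝓞 K)} (hgood : W.HasGoodReductionAt v)
    (hunr : Algebra.IsUnramifiedIn (𝓞 L) v.asIdeal)
    (w : HeightOneSpectrum (𝓞 L)) [w.asIdeal.LiesOver v.asIdeal]
    {x : W.galH1} (hx : x ∈ W.localRestrictionKer (w.adicCompletion L)) :
    x ∈ W.localRestrictionKer (v.adicCompletion K) := by
  letI : Algebra (v.adicCompletion K) (w.adicCompletion L) :=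
    (adicCompletionMap (K := K) L v w).toAlgebra
  haveI : IsScalarTower K (v.adicCompletion K) (w.adicCompletion L) :=
    IsScalarTower.of_algebraMap_eq fun x ↦ (adicCompletionMap_coe (K := K) L v w x).symm
  haveI : FiniteDimensional (v.adicCompletion K) (w.adicCompletion L) :=
    (finrank_adicCompletion_le_of_liesOver L v w).1
  haveI : FiniteDimensional K L := Module.Finite.of_restrictScalars_finite ℚ K L
  obtain ⟨𝔐, h𝔐⟩ := v.localPrimesAbove_nonempty
  let emb : L →ₐ[K] AlgebraicClosure K := IsAlgClosed.lift
  let ι : AlgebraicClosure K →ₐ[K] AlgebraicClosure (v.adicCompletion K) :=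
    closureEmb (K := K) (v.adicCompletion K)
  have hI : 𝔐.inertia (absoluteGaloisGroup (v.adicCompletion K)) ≤
      finGalSubgroup (E := v.adicCompletion K) (w.adicCompletion L) := by
    intro σ hσ
    refine mem_finGalSubgroup_adicCompletion_of_smul_eq L hθ hL v w rfl emb ι ?_
    have hρ := HeightOneSpectrum.resGalOfEmb_mem_inertia_primeBelow v ι 𝔐 hσ
    have h := smul_eq_of_mem_inertia_of_isUnramifiedIn L emb hunr
      (HeightOneSpectrum.primeBelow_mem_primesAbove h𝔐) hρ θ
    calc σ • ι (emb θ)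
        = ι ((show AlgebraicClosure K ≃ₐ[K] AlgebraicClosure K from resGalAuxOfEmb ι σ) (emb θ)) :=
          (apply_resGalAuxOfEmb_apply ι σ (emb θ)).symm
      _ = ι (emb θ) := congrArg ι h
  exact mem_localRestrictionKer_of_tower_of_inertia_le hgood h𝔐 hI hx

end NumberField

/-! ## §6 The two Galois-side inputs, exported (for descent at further places)

Appended by seat ty2 g29 (cell `bsd-print-cf2`): the `htop` / `hI` steps of the two theorems of §5,
as stand-alone statements about an arbitrary `K_v`-algebra structure on `L_w` extending the map of
completions (`halg`), so that other local vanishing mechanisms (Tamagawa-coprime unramified classes at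
places of bad reduction; divisible fixed points) can be run at the completions of `L = K + K θ`. -/

section Export

variable {K : Type u} [Field K] [NumberField K] (L : Type u) [Field L] [NumberField L] [Algebra K L]
  [Normal K L]

/-- **At a completely split place, `Γ_{K_v}` fixes every copy of `L_w`: `Γ_{L̃_w} = Γ_{K_v}`**
(`L = K + K θ`, `θ² = c ∈ K`, normal over `K`; `v` with `[L : K]` primes above it; `w ∣ v`; any
`K_v`-algebra structure on `L_w` extending the map of completions). The `htop` step of
`mem_localRestrictionKer_adicCompletion_of_ncard_primesOver_eq`, exported.
[cite: NeukirchANT1999, Ch. II §9 Prop. (9.6)] [cite: DokchitserDokchitserAnnals2010, Lemma 4.14 (proof)] -/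
theorem finGalSubgroup_adicCompletion_eq_top_of_ncard_primesOver_eq {θ : L} {c : K}
    (hθ : θ ^ 2 = algebraMap K L c)
    (hL : ∀ x : L, ∃ a b : K, x = algebraMap K L a + algebraMap K L b * θ)
    {v : HeightOneSpectrum (𝓞 K)} (hsplit : (v.asIdeal.primesOver (𝓞 L)).ncard = Module.finrank K L)
    (w : HeightOneSpectrum (𝓞 L)) [w.asIdeal.LiesOver v.asIdeal]
    [Algebra (v.adicCompletion K) (w.adicCompletion L)]
    (halg : algebraMap (v.adicCompletion K) (w.adicCompletion L) = adicCompletionMap (K := K) L v w) :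
    finGalSubgroup (E := v.adicCompletion K) (w.adicCompletion L) = ⊤ := by
  haveI : FiniteDimensional K L := Module.Finite.of_restrictScalars_finite ℚ K L
  obtain ⟨𝔐, h𝔐⟩ := v.localPrimesAbove_nonempty
  let emb : L →ₐ[K] AlgebraicClosure K := IsAlgClosed.lift
  let ι : AlgebraicClosure K →ₐ[K] AlgebraicClosure (v.adicCompletion K) :=
    closureEmb (K := K) (v.adicCompletion K)
  refine eq_top_iff.mpr fun σ _ ↦ ?_
  refine mem_finGalSubgroup_adicCompletion_of_smul_eq L hθ hL v w halg emb ι ?_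
  have hρ := resGalOfEmb_mem_decompositionSubgroup_primeBelow v ι h𝔐 σ
  have h := smul_eq_of_mem_stabilizer_of_ncard_primesOver_eq L emb hsplit
    (HeightOneSpectrum.primeBelow_mem_primesAbove h𝔐) hρ θ
  calc σ • ι (emb θ)
      = ι ((show AlgebraicClosure K ≃ₐ[K] AlgebraicClosure K from resGalAuxOfEmb ι σ) (emb θ)) :=
        (apply_resGalAuxOfEmb_apply ι σ (emb θ)).symm
    _ = ι (emb θ) := congrArg ι h

/-- **At a place unramified in `L`, the local inertia group fixes every copy of `L_w`:
`I_𝔐 ≤ Γ_{L̃_w}`** (`L = K + K θ`, `θ² = c ∈ K`, normal over `K`; `v` unramified in `L`; `w ∣ v`;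
`𝔐` a prime of `\bar 𝓞_v` above `𝓂_v`; any `K_v`-algebra structure on `L_w` extending the map of
completions). The `hI` step of `mem_localRestrictionKer_adicCompletion_of_isUnramifiedIn`, exported:
with it, ANY vanishing statement for classes of `H¹(K_v, E)` whose cocycle vanishes on inertia
(Milne *ADT* I Prop. 3.8 in Tamagawa form at bad places) descends classes from `L_w` to `K_v`.
[cite: NeukirchANT1999, Ch. I §9 Prop. (9.2)–(9.3)] [cite: MilneADT2006, Ch. I Prop. 3.8] -/
theorem inertia_le_finGalSubgroup_adicCompletion_of_isUnramifiedIn {θ : L} {c : K}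
    (hθ : θ ^ 2 = algebraMap K L c)
    (hL : ∀ x : L, ∃ a b : K, x = algebraMap K L a + algebraMap K L b * θ)
    {v : HeightOneSpectrum (𝓞 K)} (hunr : Algebra.IsUnramifiedIn (𝓞 L) v.asIdeal)
    (w : HeightOneSpectrum (𝓞 L)) [w.asIdeal.LiesOver v.asIdeal]
    [Algebra (v.adicCompletion K) (w.adicCompletion L)]
    (halg : algebraMap (v.adicCompletion K) (w.adicCompletion L) = adicCompletionMap (K := K) L v w)
    {𝔐 : Ideal v.localAbsIntegers} (h𝔐 : 𝔐 ∈ v.localPrimesAbove) :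
    𝔐.inertia (absoluteGaloisGroup (v.adicCompletion K)) ≤
      finGalSubgroup (E := v.adicCompletion K) (w.adicCompletion L) := by
  haveI : FiniteDimensional K L := Module.Finite.of_restrictScalars_finite ℚ K L
  let emb : L →ₐ[K] AlgebraicClosure K := IsAlgClosed.lift
  let ι : AlgebraicClosure K →ₐ[K] AlgebraicClosure (v.adicCompletion K) :=
    closureEmb (K := K) (v.adicCompletion K)
  intro σ hσ
  refine mem_finGalSubgroup_adicCompletion_of_smul_eq L hθ hL v w halg emb ι ?_
  have hρ := HeightOneSpectrum.resGalOfEmb_mem_inertia_primeBelow v ι 𝔐 hσ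
  have h := smul_eq_of_mem_inertia_of_isUnramifiedIn L emb hunr
    (HeightOneSpectrum.primeBelow_mem_primesAbove h𝔐) hρ θ
  calc σ • ι (emb θ)
      = ι ((show AlgebraicClosure K ≃ₐ[K] AlgebraicClosure K from resGalAuxOfEmb ι σ) (emb θ)) :=
        (apply_resGalAuxOfEmb_apply ι σ (emb θ)).symm
    _ = ι (emb θ) := congrArg ι h

end Export

end Literature.NumberTheory.EllipticCurves

end
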